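import Literature.NumberTheory.Automorphic.PatrikisCMDescentGaloisImageProofs
import Literature.NumberTheory.Automorphic.StrongMultiplicityOneRepData
import HarnessLib

/-!
# Patrikis's CM descent of the infinity type: the named fact from Clozel's theorem and the
# `L²` strong-multiplicity-one leaves (proofs)

Proofs-only companion (theorems, no definitions, no named facts) of `PatrikisCMDescent.lean`
(named fact `Patrikis2019_cmDescent`: Patrikis 2019, Prop. 2.4.7 with Rem. 2.4.8 (1);
arXiv:1207.6724 §3.2, Prop. `cmdescent` and Rem. 3.2.4 (1)), closing the chain

  `PatrikisCMDescentProofs` (Prop. 2.4.7 from its automorphic input, by Patrikis's Galois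
  argument) → `PatrikisCMDescentGaloisImageProofs` (`Patrikis2019_cmDescent_of_clozel_of_smo`:
  the fact from `Clozel1990_regularAlgebraic` — Clozel 1990, Thm. 3.13 (i), (ii), (iv) — and
  (b) strong multiplicity one WITH the archimedean components for cuspidal Borel–Jacquet data)
  → `StrongMultiplicityOneRepData` ((b) from the `L²` leaves).

Result: `Patrikis2019_cmDescent_of_clozel_of_L2` — **the named fact follows from three named
facts of the tree and nothing else**: `Clozel1990_regularAlgebraic` (Clozel's algebraicity
theorem for regular algebraic cuspidal `π`, the deep input: `Aut(ℂ)`-conjugates with conjugated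
infinity type, `ℚ(π_f)` a totally real or CM number field), `hasSatakeParamAt_iff_L2`
(Borel–Jacquet 1979, 4.6: the Satake parameters of a cuspidal datum are those of its
`L²`-realisation) and `strong_multiplicity_one_gl_sphericalLevel` (Jacquet–Shalika 1981,
Thm. 4.4 with multiplicity one, at the local spherical levels; equivalently lang.S20
`strong_multiplicity_one_gl`, `Patrikis2019_cmDescent_of_clozel_of_L2'`). Given `_holds`
theorems for these three, `Patrikis2019_cmDescent_holds` is this theorem applied to them.

## References

* S. Patrikis, *Variations on a theorem of Tate*, Mem. AMS 258 (2019), no. 1238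
  (= arXiv:1207.6724), §2.4: Prop. 2.4.7, Rem. 2.4.8 (1) (arXiv §3.2, p. 24 of the held text:
  Prop. `cmdescent`, Rem. 3.2.4 (1) "If `π` is regular, this yields an unconditional descent
  result for its infinity-type"). [Patrikis2019]
* L. Clozel, *Motifs et formes automorphes*, Perspect. Math. 10 (1990), Thm. 3.13. [Clozel1990]
* H. Jacquet, J. A. Shalika, *On Euler products and the classification of automorphic forms
  II*, Amer. J. Math. 103 (1981), Thm. 4.4. [JacquetShalikaAJM1981II]
* A. Borel, H. Jacquet, *Automorphic forms and automorphic representations*, Proc. Sympos. Pure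
  Math. 33 (1979), part 1, §4.6. [BorelJacquetCorvallis1979]
-/

noncomputable section

open scoped Classical
open NumberField IsDedekindDomain MeasureTheory

namespace Literature.NumberTheory.Automorphic

open AdelicGroupData

/-- **`Patrikis2019_cmDescent` from Clozel's theorem and the `L²` strong-multiplicity-one
leaves** (Patrikis 2019, Prop. 2.4.7 with Rem. 2.4.8 (1): "if `π` is regular, this yields an
unconditional descent result for its infinity-type"). Assume the named facts
`Clozel1990_regularAlgebraic` (Clozel 1990, Thm. 3.13 (i), (ii), (iv)), `hasSatakeParamAt_iff_L2`
for every `GL_n` over every number field and every automorphic measure (Borel–Jacquet 1979,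
4.6), and `strong_multiplicity_one_gl_sphericalLevel n K` for all `n`, `K` (Jacquet–Shalika 1981,
Thm. 4.4). Then the fact holds: the hypothesis (b) of `Patrikis2019_cmDescent_of_clozel_of_smo`
— nearly equivalent cuspidal data have infinity types with the same `a`-multisets — is
`CuspidalAutomorphicRepData.map_a_eq_of_isNearlyEquivalent` (`StrongMultiplicityOneRepData`).
[cite: Patrikis2019, Prop. 2.4.7 and Rem. 2.4.8 (1) (Mem. AMS numbering; arXiv:1207.6724 §3.2)]
[cite: JacquetShalikaAJM1981II, Thm. 4.4] -/
theorem Patrikis2019_cmDescent_of_clozel_of_L2 (hC : Clozel1990_regularAlgebraic)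
    (hL2 : ∀ (n : ℕ) (K : Type) [Field K] [NumberField K] (hcpt : isCompact_glFiniteIntegralLevel n K)
      (μ : Measure (gl n K).automorphicQuotient) [(gl n K).IsAutomorphicMeasure μ],
      hasSatakeParamAt_iff_L2 hcpt μ)
    (hsmo : ∀ (n : ℕ) (K : Type) [Field K] [NumberField K],
      strong_multiplicity_one_gl_sphericalLevel n K) :
    Patrikis2019_cmDescent :=
  Patrikis2019_cmDescent_of_clozel_of_smo hC fun n K _ _ hcpt π π' hne _ _ hT hT' ι =>
    CuspidalAutomorphicRepData.map_a_eq_of_isNearlyEquivalent (fun μ _ => hL2 n K hcpt μ) (hsmo n K)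
      π π' hne hT hT' ι

/-- The same with strong multiplicity one in the form lang.S20 (`strong_multiplicity_one_gl`, at
the levels `Kf` maximal off `S`, for every automorphic measure), which implies the spherical-level
form (`strong_multiplicity_one_gl_sphericalLevel_of_strong_multiplicity_one_gl''`,
`JacquetLanglandsLeavesProofs`). So `Patrikis2019_cmDescent` is closed modulo
`Clozel1990_regularAlgebraic`, `hasSatakeParamAt_iff_L2` and `strong_multiplicity_one_gl`.
[cite: Patrikis2019, Prop. 2.4.7 and Rem. 2.4.8 (1) (Mem. AMS numbering; arXiv:1207.6724 §3.2)]
[cite: JacquetShalikaAJM1981II, Thm. 4.4] -/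
theorem Patrikis2019_cmDescent_of_clozel_of_L2' (hC : Clozel1990_regularAlgebraic)
    (hL2 : ∀ (n : ℕ) (K : Type) [Field K] [NumberField K] (hcpt : isCompact_glFiniteIntegralLevel n K)
      (μ : Measure (gl n K).automorphicQuotient) [(gl n K).IsAutomorphicMeasure μ],
      hasSatakeParamAt_iff_L2 hcpt μ)
    (hsmo : ∀ (n : ℕ) (K : Type) [Field K] [NumberField K]
      (μ : Measure (gl n K).automorphicQuotient) [(gl n K).IsAutomorphicMeasure μ],
      strong_multiplicity_one_gl (n := n) (K := K) (μ := μ)) :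
    Patrikis2019_cmDescent :=
  Patrikis2019_cmDescent_of_clozel_of_L2 hC hL2 fun n K _ _ =>
    strong_multiplicity_one_gl_sphericalLevel_of_strong_multiplicity_one_gl'' fun μ _ => hsmo n K μ

/-- **The regular C-algebraic case over any number field, from the same three facts** (the shape
of the route crux `InfinityTypeDescent` without the "totally imaginary" hypothesis, which
Patrikis assumes only "for simplicity"): for `π` cuspidal on `GL_n(𝔸_F)` with a regular algebraic
infinity type `T`, the `a`-multisets of `T` agree at any two embeddings agreeing on every
CM-or-totally-real subfield of `F`. [cite: Patrikis2019, Prop. 2.4.7 and Rem. 2.4.8 (1) (Mem. AMS numbering; arXiv:1207.6724 §3.2)] -/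
theorem Clozel1990_regularAlgebraic.map_a_eq_of_forall_isCMField_or_isTotallyReal_of_L2
    (hC : Clozel1990_regularAlgebraic)
    (hL2 : ∀ (n : ℕ) (K : Type) [Field K] [NumberField K] (hcpt : isCompact_glFiniteIntegralLevel n K)
      (μ : Measure (gl n K).automorphicQuotient) [(gl n K).IsAutomorphicMeasure μ],
      hasSatakeParamAt_iff_L2 hcpt μ)
    (hsmo : ∀ (n : ℕ) (K : Type) [Field K] [NumberField K],
      strong_multiplicity_one_gl_sphericalLevel n K)
    {F : Type} [Field F] [NumberField F] {n : ℕ} {hcpt : isCompact_glFiniteIntegralLevel n F}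
    (π : CuspidalAutomorphicRepData n F hcpt) {T : InfinityType F n} (hT : π.1.HasInfinityType T)
    (hreg : T.IsRegularAlgebraic) {ι ι' : F →+* ℂ}
    (hιι' : ∀ M : Subfield F, (IsCMField M ∨ IsTotallyReal M) → ∀ x ∈ M, ι x = ι' x) :
    (T ι).map ArchWeight.a = (T ι').map ArchWeight.a := by
  have hπ : π.1.IsRegularAlgebraic := ⟨T, hT, hreg⟩
  haveI : FiniteDimensional ℚ (ratField π.1).toSubfield := hC.finiteDimensional_ratField π hπ
  exact T.map_a_eq_of_subgroup_invariance (heckeStabilizer π.1) (ratField π.1).toSubfield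
    (hC.isTotallyReal_or_isCMField π hπ) (fun z hz ↦ (mem_ratField_iff π.1 z).mpr hz)
    (fun σ hσ ι₀ ↦ hC.map_a_autConj_eq_of_mem_heckeStabilizer π hT hreg
      (fun π' hne T' hT' ↦ CuspidalAutomorphicRepData.map_a_eq_of_isNearlyEquivalent
        (fun μ _ => hL2 n F hcpt μ) (hsmo n F) π π' hne hT hT') hσ ι₀)
    hιι'

end Literature.NumberTheory.Automorphic
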